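import Literature.MathematicalPhysics.QuantumFieldTheory.Balaban1983to89.Beta.HessKerSchurResolvent
import Literature.MathematicalPhysics.QuantumFieldTheory.Balaban1983to89.T4RateAlgebra

/-!
# `Balaban1983to89.Beta.HessKerSchurCauchy` — road A2 / (SW1) of the β sub-cell IN SCALE-TO-SCALE (CAUCHY) FORM:
# the limit primitives `𝔎_∞, S_∞, W_∞` and the limit one-step operator `ℌ_∞` are NOT needed
# (asymptotic lane asym1, gen 9, item 1, v1; CONSTANTS half of the template, bookkeeping only)

HONEST FRAMING (cell contract, verbatim): «discharging `BetaPertH` makes Bałaban's UV stability UNCONDITIONAL — a real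
constructive-QFT result; it is NOT the continuum limit and NOT the Clay problem.»  THIS MODULE is [folklore] real analysis on `ℤ^D`
(pointwise limits of Cauchy sequences, closedness of `≤`, the tree's Lipschitz lemmas applied between two FINITE levels); it
formalises NO statement printed in Bałaban's papers, cites none as a hypothesis, mints no `Prop` fact, instantiates NO binder of the
wall (RULING (R18-3)) and DISCHARGES NOTHING of it.  NOT summit progress.

ABSOLUTE RULE (cell, verbatim): «No internally-minted statement may enter as a cited fact. Every hypothesis is either
kernel-proved in this package or a verbatim quotation of a PUBLISHED theorem with page reference. The manuscript(s) under
audit are NOT citable for their own disputed steps — they are the thing under adjudication; programme-internal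
(2001/route/tribunal) claims are never citable.»  Every theorem below is kernel-proved from explicit, abstract hypotheses on
matrix-fibred kernels; nothing asserts that any kernel IS Bałaban's.  The one predicate introduced (`AllScalesRate`) is a
HYPOTHESIS SHAPE with free constants, never asserted.

WHY THIS LEAF (interface bookkeeping for O-asym1-1 / O-asym1-6).  The END corollaries of the asym1 chain —
`HessKerSchur.geomRate_secondMoment_hessKer_primitivesW[_of_pointwise]` (§7) and
`HessKerSchurResolvent.geomRate_secondMoment_hessKer_operatorsW` (§5) — are stated AGAINST LIMIT OBJECTS: a limit resolvent
`K_∞` with `ColW (K j − K_∞) R (c_K θ^j)`, limit stencil / vertex tables `S_∞`, `W_∞`, and (operator form) a limit one-step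
operator `H_∞` with the right-inverse relation `comp H_∞ G_∞ = idK`.  Two facts about the cell make that the wrong currency:
(a) nobody has typed Bałaban's limit one-step operator on `ℤ^{d+1}` (its field block is the NON-LOCAL effective Laplacian after
infinitely many averaging steps; compare the scope section of `Beta/VectorPropagatorLimit`: the infinite-volume `Δ_a` contains the
non-local `P` of B5 (1.70), «which nobody has typed on `ℤ^d`»), while the FINITE-level (rescaled, RULING (R25-1)) operators and their
two-sided inverses ARE typed objects of row an2;
(b) the suppliers' native output is CAUCHY-IN-SCALE, not deviation-from-a-limit: t4-ne2's position-space η-rates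
`T4Hk163StripRate.latticeKernel_G163_rate[_king]` / `T4GaugeActionRateStrip.latticeKernel_Gsym_rate`
(`‖K^{(m)}(x) − K^{(n)}(x)‖ ≤ (C/n)·e^{−κ|x|_∞}` for `n ≤ m` at the same physical offset; King's shape `n = L^k`, `m = L^{k+j}`), the
U1 ⟷ BETA liaison currency `T4RateAlgebra.RatePair` = (UD) + (PR′), and `LimitRate.StepRate` (an5: «the natural scale-to-scale
deliverable of rows an1/an2»).  This leaf re-states road A2 in that currency, with explicit constants and NO limit object among the
hypotheses: the β-limit is SUPPLIED by telescoping (`LimitRate.limKernelOf`), and road B (`RateCertificate.GeomRate S.β0 b_∞ c₀ θ`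
⟹ `beta0_pos_all_of_*`) never needs a closed form of `b_∞` (the cap lanes bound it from certified finite-`k` values `± c₀θ^k`).

CONTENT (all [folklore]).
* §1 THE ALL-SCALES (King) SHAPE `AllScalesRate P μ ν C′ δ′ θ := ∀ k j, Decay510 (P(k+j) − P k) (C′θ^k) δ′` for a scalar-entry
  family `P : ℕ → B12Beta.Kernel D`: ⟹ `LimitRate.StepRate` (take `j = 1`); ⟹ `LimitRate.GeometricRate P (limKernelOf P) μ ν C′ δ′ θ`
  with the SAME constant `C′` — no `1/(1−θ)` (pointwise limit `j → ∞`, `le_of_tendsto`; the successive form loses `1/(1−θ)`,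
  `LimitRate.StepRate.geometricRate`); conversely (PR) ⟹ all-scales with `2C′`; (UD) + all-scales ⟹ `GeomRate` of the second
  moments to `secondMoment (limKernelOf P)` with `c₀ = betaPrime510 D C′ δ′`.
* §2 `hessKer A V W` (general `D`, fibre `F`; half-rate first-order vertices as in `HessKerSchur` §6): `j`-UNIFORM weighted data
  `ColW (A k) R B_A`, `VertexFamilyW (V k) N (R/2) B_V`, `VertexFamily₂W (W k) N R B_W` and CONSECUTIVE-SCALE deviations
  `ColW (A(k+1) − A k) R (c_A θ^k)`, … (resp. ALL-SCALES deviations `ColW (A(k+j) − A k) R (c_A θ^k)`, …) ⟹ `StepRate` (resp.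
  `AllScalesRate`) of `k ↦ hessKer (A k) (V k) (W k)` with constant `lipW B_A B_A B_V B_V B_W c_A c_V c_W` at rate `R·N` — this is
  `HessKerSchur.decay510_hessKer_sub_halfV` applied between the two FINITE levels; packaged as `T4RateAlgebra.RatePair` BY NAME
  (`ratePair_hessKer_halfV_step`); END `geomRate_secondMoment_hessKer_halfV_step` (c₀ = betaPrime510 D (lipW …/(1−θ)) (R·N)) and
  `…_allScales` (c₀ = betaPrime510 D (lipW …) (R·N) — the tree's constant, limit := `limKernelOf`).
* §3 THE PRIMITIVES `(K_k, S_k, W_k)` (the literal `TstepOf` shape `hessKer K (vertexOfK K N S) W`, fibre `Fib d`):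
  `vertexFamilyW_vertexOfK_step|_allScales` (from `HessKerSchur.vertexFamilyW_vertexOfK_sub` between levels), then
  `stepRate_/allScalesRate_hessKer_primitivesW`, `ratePair_hessKer_primitivesW_step`, and the END corollaries
  `geomRate_secondMoment_hessKer_primitivesW_step|_allScales`, `oneLoopDrift_secondMoment_hessKer_primitivesW_allScales`.
* §4 THE RESOLVENT BETWEEN TWO FINITE LEVELS: two-sided inverse relations `comp (G k) (H k) = idK`, `comp (H k) (G k) = idK` AT EVERY
  LEVEL, uniform `ColW (G k) R B_G`, `ColW (H k) R B_H` and operator deviations `ColW (H(k+1) − H k) R (c_H θ^k)` (resp. all-scales)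
  ⟹ `ColW (G(k+1) − G k) R (B_G c_H B_G θ^k)` (resp. all-scales) — `HessKerSchurResolvent.colW_resolvent_sub` with `G := G(k+1)`,
  `G′ := G k`; NO `H_∞`, NO `G_∞`; END `geomRate_secondMoment_hessKer_operatorsW_step|_allScales`.
* §5 POINTWISE (`Decays`-form) all-scales data on the primitives (`HessKerRate` §6's classes), at any target rate below the decay rates:
  `geomRate_secondMoment_hessKer_primitivesW_of_pointwise_allScales` (the lattice constant `Zl` paid once per primitive, as in the tree's
  `_of_pointwise`).  Sup-norm data `e^{−κ|x|_∞}` convert to this by `Beta.FibreInverseDecay.exp_supNorm_le_exp_l1` (rate `κ/(d+1)`), BY NAME.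

UPSHOT (O-asym1-1, restated WITHOUT limit objects — (CONV-C-Cauchy)): for the (R25-1)-rescaled finite-level primitives it suffices that
suppliers deliver, in the weighted classes the chain consumes (or pointwise, §5), `k`-UNIFORM bounds and CONSECUTIVE-SCALE (or King
all-scales) DEVIATIONS `ColW (𝔎_{k+1} − 𝔎_k) R (c θ^k)` — or, through §4, the same for the finite-level one-step OPERATORS together with
the finite-level inverse relations — plus the stencil / vertex analogues.  Nothing here says that Bałaban's objects satisfy them; that is
supplier data (OPEN, not in print: O-an2-2 / O-asym1-1; t4-ne2's per-symbol rates are the printed-type ingredients).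

RELATION TO THE TREE (no duplication): `LimitRate.StepRate`, `limKernelOf`, `StepRate.geometricRate` (C′/(1−θ)), `StepRate.tendsto_apply`,
`GeometricRate.limKernelOf_eq`, `abs_secondMoment_sub_limit_le` (an5) and `T4RateAlgebra.RatePair` / `ratePair_iff_uniformDecay_and_stepRate`
(t4 liaison; closure algebra of SCALAR rate pairs) are USED BY NAME; `HessKerSchur` §6–§7 and `HessKerSchurResolvent` §4 supply the Lipschitz /
resolvent bricks.  New here: the all-scales sharpening (no `1/(1−θ)`), the Cauchy-form END corollaries for matrix-fibred primitives in the
weighted classes, and the finite-level resolvent step.  King's printed A = 0 sibling of the all-scales shape is [King1986] Lemma 4.5 (4.38)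
p. 674 (CONTEXT for the SHAPE only; nothing of it is used; quotation as render-checked in `T4RateAlgebra`'s header).

WHAT IS NOT HERE (located, NOT in print, NOT claimed): any of the hypotheses for Bałaban's (rescaled) primitives / operators; any numeric
value of `B_•, c_•, θ, R`; the identification of `secondMoment (limKernelOf …)` with `b₀ ln L`-type numbers (cap lanes / road B).  NOT
continuum, NOT Clay.
-/

open Finset Filter Topology
open scoped BigOperators
open Literature.MathematicalPhysics.QuantumFieldTheory.Balaban1983to89
open Literature.MathematicalPhysics.QuantumFieldTheory.Balaban1983to89.Beta
open B12Sec2to5 (l1 l1_nonneg Decay510 betaPrime510)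
open ExpKernelCalculus (MKer Decays VertexFamily₂ hessKer comp Zl)
open LimitRate (GeometricRate StepRate limKernelOf subKernel subKernel_apply)
open HessKerSchur (ColW VertexFamilyW VertexFamily₂W hessW lipW lipW_mul LocStencilW colW_of_decays locStencilW_of_locStencil
  vertexFamily₂W_of_vertexFamily₂ decay510_hessKer_sub_halfV uniformDecay_hessKer_halfV vertexFamilyW_vertexOfK vertexFamilyW_vertexOfK_sub)
open HessKerSchurResolvent (idK colW_resolvent_sub colW_sub_comm)
open OneStepResolventKernel (Fib LocStencil)
open OneStepKernelFamily (vertexOfK)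
open T4RateAlgebra (RatePair)

namespace Literature.MathematicalPhysics.QuantumFieldTheory.Balaban1983to89.Beta.HessKerSchurCauchy

noncomputable section

/-! ## §1 The all-scales (King) shape and the telescoped limit WITHOUT the `1/(1−θ)` loss -/

section AllScales

variable {D : ℕ}

/-- **(PR″) ALL-SCALES FORM** of propagator-convergence with a rate: the levels `k` and `k + j` differ by `≤ C′θ^k e^{−δ′|x|₁}` for ALL
`j` (the shape `n ≤ m`, same physical offset, of the suppliers' position-space η-rates; King's `C^{(k)} − C^{(k+n)}` shape).  A PREDICATE
(hypothesis shape) with free constants; NOT PRINTED for the kernels of the series under audit and never asserted here. [folklore] -/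
def AllScalesRate (P : ℕ → B12Beta.Kernel D) (μ ν : Fin D) (C' δ' θ : ℝ) : Prop :=
  ∀ k j, Decay510 (subKernel (P (k + j)) (P k) μ ν) (C' * θ ^ k) δ'

/-- The constant of an all-scales bound is `≥ 0` (evaluate at `k = j = 0`, `x = 0`). [folklore] -/
theorem AllScalesRate.const_nonneg {P : ℕ → B12Beta.Kernel D} {μ ν : Fin D} {C' δ' θ : ℝ} (h : AllScalesRate P μ ν C' δ' θ) :
    0 ≤ C' := by
  have h0 := h 0 0 0
  simp only [Nat.add_zero, subKernel_apply, sub_self, abs_zero, LimitRate.l1_zero, pow_zero, mul_zero, Real.exp_zero, mul_one] at h0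
  exact h0

/-- All-scales ⟹ one-step (take `j = 1`), SAME constants. [folklore] -/
theorem AllScalesRate.stepRate {P : ℕ → B12Beta.Kernel D} {μ ν : Fin D} {C' δ' θ : ℝ} (h : AllScalesRate P μ ν C' δ' θ) :
    StepRate P μ ν C' δ' θ :=
  fun k => h k 1

/-- Under an all-scales bound with `0 ≤ θ < 1` the shifted family `j ↦ P (k + j)` converges pointwise to the telescoped limit kernel.
[folklore] -/
theorem AllScalesRate.tendsto_shift {P : ℕ → B12Beta.Kernel D} {μ ν : Fin D} {C' δ' θ : ℝ} (h : AllScalesRate P μ ν C' δ' θ)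
    (hθ0 : 0 ≤ θ) (hθ1 : θ < 1) (k : ℕ) (x : Fin D → ℤ) :
    Tendsto (fun j => P (k + j) μ ν x) atTop (𝓝 (limKernelOf P μ ν x)) := by
  have ht := (tendsto_add_atTop_iff_nat k).mpr (h.stepRate.tendsto_apply hθ0 hθ1 x)
  refine ht.congr fun j => ?_
  rw [Nat.add_comm]

/-- **ALL-SCALES ⟹ (PR) WITH THE SAME CONSTANT** (no `1/(1−θ)`): `|P_k(x) − P_∞(x)| ≤ C′θ^k e^{−δ′|x|₁}` for the telescoped limit
`P_∞ = limKernelOf P` — let `j → ∞` in the all-scales bound (`le_of_tendsto`). [folklore] -/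
theorem AllScalesRate.geometricRate {P : ℕ → B12Beta.Kernel D} {μ ν : Fin D} {C' δ' θ : ℝ} (h : AllScalesRate P μ ν C' δ' θ)
    (hθ0 : 0 ≤ θ) (hθ1 : θ < 1) : GeometricRate P (limKernelOf P) μ ν C' δ' θ := by
  intro k x
  rw [subKernel_apply]
  have ht : Tendsto (fun j => |P k μ ν x - P (k + j) μ ν x|) atTop (𝓝 |P k μ ν x - limKernelOf P μ ν x|) :=
    (tendsto_const_nhds.sub (h.tendsto_shift hθ0 hθ1 k x)).abs
  refine le_of_tendsto ht (Eventually.of_forall fun j => ?_)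
  have := h k j x
  rw [subKernel_apply, abs_sub_comm] at this
  exact this

/-- Uniqueness: any kernel `P_∞` with (PR) agrees entrywise (in the `(μ,ν)` component) with the telescoped one — so an all-scales family
has exactly one geometric limit. (`LimitRate.GeometricRate.limKernelOf_eq`, recorded for the interface.) [folklore] -/
theorem AllScalesRate.limKernelOf_unique {P : ℕ → B12Beta.Kernel D} {Pinf : B12Beta.Kernel D} {μ ν : Fin D} {C' C'' δ' δ'' θ : ℝ}
    (_h : AllScalesRate P μ ν C' δ' θ) (hinf : GeometricRate P Pinf μ ν C'' δ'' θ) (hθ0 : 0 ≤ θ) (hθ1 : θ < 1) (x : Fin D → ℤ) :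
    limKernelOf P μ ν x = Pinf μ ν x :=
  hinf.limKernelOf_eq hθ0 hθ1 x

/-- **(PR) ⟹ ALL-SCALES** with constant `2C′` (`0 ≤ θ ≤ 1`): both levels are within `C′θ^k e^{−δ′|x|₁}` of the limit. [folklore] -/
theorem GeometricRate.allScalesRate {P : ℕ → B12Beta.Kernel D} {Pinf : B12Beta.Kernel D} {μ ν : Fin D} {C' δ' θ : ℝ}
    (h : GeometricRate P Pinf μ ν C' δ' θ) (hθ0 : 0 ≤ θ) (hθ1 : θ ≤ 1) : AllScalesRate P μ ν (2 * C') δ' θ := by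
  intro k j x
  have hC' : 0 ≤ C' := h.const_nonneg
  have h1 := h (k + j) x
  have h0 := h k x
  rw [subKernel_apply] at h1 h0 ⊢
  have hE : 0 ≤ Real.exp (-δ' * l1 x) := (Real.exp_pos _).le
  have hpow : θ ^ (k + j) ≤ θ ^ k := by
    rw [pow_add]; exact mul_le_of_le_one_right (pow_nonneg hθ0 k) (pow_le_one₀ hθ0 hθ1)
  have h1' : |P (k + j) μ ν x - Pinf μ ν x| ≤ C' * θ ^ k * Real.exp (-δ' * l1 x) :=
    h1.trans (mul_le_mul_of_nonneg_right (mul_le_mul_of_nonneg_left hpow hC') hE)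
  calc |P (k + j) μ ν x - P k μ ν x|
        = |(P (k + j) μ ν x - Pinf μ ν x) - (P k μ ν x - Pinf μ ν x)| := by rw [sub_sub_sub_cancel_right]
    _ ≤ |P (k + j) μ ν x - Pinf μ ν x| + |P k μ ν x - Pinf μ ν x| := abs_sub _ _
    _ ≤ C' * θ ^ k * Real.exp (-δ' * l1 x) + C' * θ ^ k * Real.exp (-δ' * l1 x) := add_le_add h1' h0
    _ = 2 * C' * θ ^ k * Real.exp (-δ' * l1 x) := by ring

/-- **(UD) + ALL-SCALES ⟹ (AF-0r) to the TELESCOPED limit with `c₀ = β′(C′, δ′)`:**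
`|secondMoment (P k) − secondMoment (limKernelOf P)| ≤ betaPrime510 D C′ δ′ · θ^k`. [folklore] -/
theorem AllScalesRate.geomRate_secondMoment {P : ℕ → B12Beta.Kernel D} {μ ν : Fin D} {C δ C' δ' θ : ℝ}
    (hU : LimitRate.UniformDecay P μ ν C δ) (h : AllScalesRate P μ ν C' δ' θ) (hδ : 0 < δ) (hδ' : 0 < δ') (hθ0 : 0 ≤ θ)
    (hθ1 : θ < 1) :
    RateCertificate.GeomRate (fun k => B12Beta.secondMoment (P k) μ ν) (B12Beta.secondMoment (limKernelOf P) μ ν)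
      (betaPrime510 D C' δ') θ :=
  fun k => LimitRate.abs_secondMoment_sub_limit_le hU (h.geometricRate hθ0 hθ1) hδ hδ' k

/-- **(UD) + ONE-STEP ⟹ (AF-0r) to the telescoped limit with `c₀ = β′(C′/(1−θ), δ′)`** (`LimitRate.StepRate.geometricRate`). [folklore] -/
theorem StepRate.geomRate_secondMoment {P : ℕ → B12Beta.Kernel D} {μ ν : Fin D} {C δ C' δ' θ : ℝ}
    (hU : LimitRate.UniformDecay P μ ν C δ) (h : StepRate P μ ν C' δ' θ) (hδ : 0 < δ) (hδ' : 0 < δ') (hθ0 : 0 ≤ θ)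
    (hθ1 : θ < 1) :
    RateCertificate.GeomRate (fun k => B12Beta.secondMoment (P k) μ ν) (B12Beta.secondMoment (limKernelOf P) μ ν)
      (betaPrime510 D (C' / (1 - θ)) δ') θ :=
  fun k => LimitRate.abs_secondMoment_sub_limit_le hU (h.geometricRate hθ0 hθ1) hδ hδ' k

/-- DICTIONARY with the liaison currency: a `T4RateAlgebra.RatePair` of the `(μ,ν)` components whose rate half holds at ALL scales is
(UD) + `AllScalesRate` (definitional reading; the pair itself records only the one-step half). [folklore] -/
theorem ratePair_of_allScalesRate {P : ℕ → B12Beta.Kernel D} {μ ν : Fin D} {C δ C' θ : ℝ}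
    (hU : LimitRate.UniformDecay P μ ν C δ) (h : AllScalesRate P μ ν C' δ θ) : RatePair (fun k => P k μ ν) C δ C' θ :=
  (T4RateAlgebra.ratePair_iff_uniformDecay_and_stepRate P μ ν C δ C' θ).mpr ⟨hU, h.stepRate⟩

end AllScales

/-! ## §2 `hessKer A V W` from scale-to-scale data in the weighted classes (half-rate first-order vertices) -/

section HalfV

variable {D : ℕ} {F : Type*} [Fintype F]
variable {A : ℕ → MKer D F} {V : ℕ → Fin D → (Fin D → ℤ) → MKer D F}
  {W : ℕ → Fin D → (Fin D → ℤ) → Fin D → (Fin D → ℤ) → MKer D F} {R BA BV BW cA cV cW θ : ℝ} {N : ℕ}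

/-- **ONE-STEP FORM.**  `k`-uniform weighted data and CONSECUTIVE-SCALE deviations in the weighted classes ⟹ `LimitRate.StepRate` of
`k ↦ hessKer (A k) (V k) (W k)` with constant `lipW B_A B_A B_V B_V B_W c_A c_V c_W` at rate `R·N` — the Lipschitz lemma
`HessKerSchur.decay510_hessKer_sub_halfV` between the two finite levels `k+1`, `k`. [folklore] -/
theorem stepRate_hessKer_halfV (hA : ∀ k, ColW (A k) R BA) (hAstep : ∀ k, ColW (A (k + 1) - A k) R (cA * θ ^ k))
    (hV : ∀ k, VertexFamilyW (V k) N (R / 2) BV) (hVstep : ∀ k, VertexFamilyW (V (k + 1) - V k) N (R / 2) (cV * θ ^ k))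
    (hW : ∀ k, VertexFamily₂W (W k) N R BW) (hWstep : ∀ k, VertexFamily₂W (W (k + 1) - W k) N R (cW * θ ^ k)) (hR : 0 < R)
    (μ ν : Fin D) : StepRate (fun k => hessKer (A k) (V k) (W k)) μ ν (lipW BA BA BV BV BW cA cV cW) (R * N) θ := by
  intro k
  have h := decay510_hessKer_sub_halfV (hA (k + 1)) (hA k) (hAstep k) (hV (k + 1)) (hV k) (hVstep k) (hW (k + 1)) (hW k)
    (hWstep k) hR μ ν
  rw [lipW_mul] at h
  intro x
  simpa [LimitRate.subKernel] using h x

/-- **ALL-SCALES FORM.**  The same with deviations between the levels `k + j` and `k` for all `j` ⟹ `AllScalesRate` with the same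
constant. [folklore] -/
theorem allScalesRate_hessKer_halfV (hA : ∀ k, ColW (A k) R BA) (hAall : ∀ k j, ColW (A (k + j) - A k) R (cA * θ ^ k))
    (hV : ∀ k, VertexFamilyW (V k) N (R / 2) BV) (hVall : ∀ k j, VertexFamilyW (V (k + j) - V k) N (R / 2) (cV * θ ^ k))
    (hW : ∀ k, VertexFamily₂W (W k) N R BW) (hWall : ∀ k j, VertexFamily₂W (W (k + j) - W k) N R (cW * θ ^ k)) (hR : 0 < R)
    (μ ν : Fin D) : AllScalesRate (fun k => hessKer (A k) (V k) (W k)) μ ν (lipW BA BA BV BV BW cA cV cW) (R * N) θ := by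
  intro k j
  have h := decay510_hessKer_sub_halfV (hA (k + j)) (hA k) (hAall k j) (hV (k + j)) (hV k) (hVall k j) (hW (k + j)) (hW k)
    (hWall k j) hR μ ν
  rw [lipW_mul] at h
  intro x
  simpa [LimitRate.subKernel] using h x

/-- **THE LIAISON CURRENCY BY NAME**: under the one-step hypotheses and `0 ≤ R`, every `(μ,ν)` component of `k ↦ hessKer (A k) (V k) (W k)`
is a `T4RateAlgebra.RatePair` with (UD) constant `hessW B_A B_V B_W`, rate `R·N`, (PR′) constant `lipW …`. [folklore] -/
theorem ratePair_hessKer_halfV_step (hA : ∀ k, ColW (A k) R BA) (hAstep : ∀ k, ColW (A (k + 1) - A k) R (cA * θ ^ k))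
    (hV : ∀ k, VertexFamilyW (V k) N (R / 2) BV) (hVstep : ∀ k, VertexFamilyW (V (k + 1) - V k) N (R / 2) (cV * θ ^ k))
    (hW : ∀ k, VertexFamily₂W (W k) N R BW) (hWstep : ∀ k, VertexFamily₂W (W (k + 1) - W k) N R (cW * θ ^ k)) (hR : 0 < R)
    (μ ν : Fin D) :
    RatePair (fun k => hessKer (A k) (V k) (W k) μ ν) (hessW BA BV BW) (R * N) (lipW BA BA BV BV BW cA cV cW) θ :=
  (T4RateAlgebra.ratePair_iff_uniformDecay_and_stepRate _ μ ν _ _ _ _).mpr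
    ⟨uniformDecay_hessKer_halfV hA hV hW hR.le μ ν, stepRate_hessKer_halfV hA hAstep hV hVstep hW hWstep hR μ ν⟩

/-- **(SW1)-SHAPE CONCLUSION FROM ONE-STEP DATA**, limit SUPPLIED by telescoping: `GeomRate` of the second moments to
`secondMoment (limKernelOf (k ↦ hessKer (A k) (V k) (W k))) μ ν` with `c₀ = betaPrime510 D (lipW …/(1−θ)) (R·N)` (`1 ≤ N`, `0 ≤ θ < 1`).
[folklore] -/
theorem geomRate_secondMoment_hessKer_halfV_step (hA : ∀ k, ColW (A k) R BA) (hAstep : ∀ k, ColW (A (k + 1) - A k) R (cA * θ ^ k))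
    (hV : ∀ k, VertexFamilyW (V k) N (R / 2) BV) (hVstep : ∀ k, VertexFamilyW (V (k + 1) - V k) N (R / 2) (cV * θ ^ k))
    (hW : ∀ k, VertexFamily₂W (W k) N R BW) (hWstep : ∀ k, VertexFamily₂W (W (k + 1) - W k) N R (cW * θ ^ k)) (hR : 0 < R)
    (hN : 1 ≤ N) (hθ0 : 0 ≤ θ) (hθ1 : θ < 1) (μ ν : Fin D) :
    RateCertificate.GeomRate (fun k => B12Beta.secondMoment (hessKer (A k) (V k) (W k)) μ ν)
      (B12Beta.secondMoment (limKernelOf (fun k => hessKer (A k) (V k) (W k))) μ ν)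
      (betaPrime510 D (lipW BA BA BV BV BW cA cV cW / (1 - θ)) (R * N)) θ := by
  have hRN : 0 < R * (N : ℝ) := mul_pos hR (by exact_mod_cast (show 0 < N by omega))
  exact StepRate.geomRate_secondMoment (uniformDecay_hessKer_halfV hA hV hW hR.le μ ν)
    (stepRate_hessKer_halfV hA hAstep hV hVstep hW hWstep hR μ ν) hRN hRN hθ0 hθ1

/-- **(SW1)-SHAPE CONCLUSION FROM ALL-SCALES DATA**: the tree's constant `c₀ = betaPrime510 D (lipW …) (R·N)` (no `1/(1−θ)`), limit
supplied by telescoping. [folklore] -/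
theorem geomRate_secondMoment_hessKer_halfV_allScales (hA : ∀ k, ColW (A k) R BA)
    (hAall : ∀ k j, ColW (A (k + j) - A k) R (cA * θ ^ k))
    (hV : ∀ k, VertexFamilyW (V k) N (R / 2) BV) (hVall : ∀ k j, VertexFamilyW (V (k + j) - V k) N (R / 2) (cV * θ ^ k))
    (hW : ∀ k, VertexFamily₂W (W k) N R BW) (hWall : ∀ k j, VertexFamily₂W (W (k + j) - W k) N R (cW * θ ^ k)) (hR : 0 < R)
    (hN : 1 ≤ N) (hθ0 : 0 ≤ θ) (hθ1 : θ < 1) (μ ν : Fin D) :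
    RateCertificate.GeomRate (fun k => B12Beta.secondMoment (hessKer (A k) (V k) (W k)) μ ν)
      (B12Beta.secondMoment (limKernelOf (fun k => hessKer (A k) (V k) (W k))) μ ν)
      (betaPrime510 D (lipW BA BA BV BV BW cA cV cW) (R * N)) θ := by
  have hRN : 0 < R * (N : ℝ) := mul_pos hR (by exact_mod_cast (show 0 < N by omega))
  exact AllScalesRate.geomRate_secondMoment (uniformDecay_hessKer_halfV hA hV hW hR.le μ ν)
    (allScalesRate_hessKer_halfV hA hAall hV hVall hW hWall hR μ ν) hRN hRN hθ0 hθ1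

end HalfV

/-! ## §3 The primitives `(K_k, S_k, W_k)` — the `TstepOf` shape `hessKer K (vertexOfK K N S) W` -/

section Primitives

variable {d : ℕ}
variable {K : ℕ → MKer (d + 1) (Fib d)} {S : ℕ → Fin (d + 1) → (Fin (d + 1) → ℤ) → MKer (d + 1) (Fib d)}
  {W : ℕ → Fin (d + 1) → (Fin (d + 1) → ℤ) → Fin (d + 1) → (Fin (d + 1) → ℤ) → MKer (d + 1) (Fib d)}
  {R BK cK Bs cS BW cW θ : ℝ} {N : ℕ}

/-- The chain-rule vertex between two levels: `ColW (K(k+1) − K k) R (c_K θ^k)`, `LocStencilW (S(k+1) − S k) (R/2) (c_S θ^k)` + uniform data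
⟹ `VertexFamilyW (vertexOfK (K(k+1)) N (S(k+1)) − vertexOfK (K k) N (S k)) N (R/2) ((c_K B_s + B_K c_S) θ^k)`. [folklore] -/
theorem vertexFamilyW_vertexOfK_step (hK : ∀ k, ColW (K k) R BK) (hKstep : ∀ k, ColW (K (k + 1) - K k) R (cK * θ ^ k))
    (hS : ∀ k, LocStencilW (S k) (R / 2) Bs) (hSstep : ∀ k, LocStencilW (S (k + 1) - S k) (R / 2) (cS * θ ^ k)) (hR : 0 < R)
    (N : ℕ) (k : ℕ) :
    VertexFamilyW (vertexOfK (K (k + 1)) N (S (k + 1)) - vertexOfK (K k) N (S k)) N (R / 2) ((cK * Bs + BK * cS) * θ ^ k) :=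
  (vertexFamilyW_vertexOfK_sub (hK (k + 1)) (hK k) (hKstep k) (hS (k + 1)) (hS k) (hSstep k) hR N).mono (le_of_eq (by ring))

/-- … all-scales form. [folklore] -/
theorem vertexFamilyW_vertexOfK_allScales (hK : ∀ k, ColW (K k) R BK) (hKall : ∀ k j, ColW (K (k + j) - K k) R (cK * θ ^ k))
    (hS : ∀ k, LocStencilW (S k) (R / 2) Bs) (hSall : ∀ k j, LocStencilW (S (k + j) - S k) (R / 2) (cS * θ ^ k)) (hR : 0 < R)
    (N : ℕ) (k j : ℕ) :
    VertexFamilyW (vertexOfK (K (k + j)) N (S (k + j)) - vertexOfK (K k) N (S k)) N (R / 2) ((cK * Bs + BK * cS) * θ ^ k) :=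
  (vertexFamilyW_vertexOfK_sub (hK (k + j)) (hK k) (hKall k j) (hS (k + j)) (hS k) (hSall k j) hR N).mono (le_of_eq (by ring))

/-- **ONE-STEP FORM FROM THE PRIMITIVES**: `StepRate` of `k ↦ hessKer (K k) (vertexOfK (K k) N (S k)) (W k)` with constant
`lipW B_K B_K (B_K B_s) (B_K B_s) B_W c_K (c_K B_s + B_K c_S) c_W` at rate `R·N`. [folklore] -/
theorem stepRate_hessKer_primitivesW (hK : ∀ k, ColW (K k) R BK) (hKstep : ∀ k, ColW (K (k + 1) - K k) R (cK * θ ^ k))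
    (hS : ∀ k, LocStencilW (S k) (R / 2) Bs) (hSstep : ∀ k, LocStencilW (S (k + 1) - S k) (R / 2) (cS * θ ^ k))
    (hW : ∀ k, VertexFamily₂W (W k) N R BW) (hWstep : ∀ k, VertexFamily₂W (W (k + 1) - W k) N R (cW * θ ^ k)) (hR : 0 < R)
    (μ ν : Fin (d + 1)) :
    StepRate (fun k => hessKer (K k) (vertexOfK (K k) N (S k)) (W k)) μ ν
      (lipW BK BK (BK * Bs) (BK * Bs) BW cK (cK * Bs + BK * cS) cW) (R * N) θ :=
  stepRate_hessKer_halfV (V := fun k => vertexOfK (K k) N (S k)) hK hKstep (fun k => vertexFamilyW_vertexOfK (hK k) (hS k) hR N)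
    (fun k => vertexFamilyW_vertexOfK_step hK hKstep hS hSstep hR N k) hW hWstep hR μ ν

/-- **ALL-SCALES FORM FROM THE PRIMITIVES.** [folklore] -/
theorem allScalesRate_hessKer_primitivesW (hK : ∀ k, ColW (K k) R BK) (hKall : ∀ k j, ColW (K (k + j) - K k) R (cK * θ ^ k))
    (hS : ∀ k, LocStencilW (S k) (R / 2) Bs) (hSall : ∀ k j, LocStencilW (S (k + j) - S k) (R / 2) (cS * θ ^ k))
    (hW : ∀ k, VertexFamily₂W (W k) N R BW) (hWall : ∀ k j, VertexFamily₂W (W (k + j) - W k) N R (cW * θ ^ k)) (hR : 0 < R)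
    (μ ν : Fin (d + 1)) :
    AllScalesRate (fun k => hessKer (K k) (vertexOfK (K k) N (S k)) (W k)) μ ν
      (lipW BK BK (BK * Bs) (BK * Bs) BW cK (cK * Bs + BK * cS) cW) (R * N) θ :=
  allScalesRate_hessKer_halfV (V := fun k => vertexOfK (K k) N (S k)) hK hKall (fun k => vertexFamilyW_vertexOfK (hK k) (hS k) hR N)
    (fun k j => vertexFamilyW_vertexOfK_allScales hK hKall hS hSall hR N k j) hW hWall hR μ ν

/-- **THE LIAISON CURRENCY FROM THE PRIMITIVES**: every `(μ,ν)` component of the `TstepOf`-shaped family is a `T4RateAlgebra.RatePair` with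
(UD) constant `hessW B_K (B_K B_s) B_W`, rate `R·N`, (PR′) constant `lipW …`. [folklore] -/
theorem ratePair_hessKer_primitivesW_step (hK : ∀ k, ColW (K k) R BK) (hKstep : ∀ k, ColW (K (k + 1) - K k) R (cK * θ ^ k))
    (hS : ∀ k, LocStencilW (S k) (R / 2) Bs) (hSstep : ∀ k, LocStencilW (S (k + 1) - S k) (R / 2) (cS * θ ^ k))
    (hW : ∀ k, VertexFamily₂W (W k) N R BW) (hWstep : ∀ k, VertexFamily₂W (W (k + 1) - W k) N R (cW * θ ^ k)) (hR : 0 < R)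
    (μ ν : Fin (d + 1)) :
    RatePair (fun k => hessKer (K k) (vertexOfK (K k) N (S k)) (W k) μ ν) (hessW BK (BK * Bs) BW) (R * N)
      (lipW BK BK (BK * Bs) (BK * Bs) BW cK (cK * Bs + BK * cS) cW) θ :=
  ratePair_hessKer_halfV_step (V := fun k => vertexOfK (K k) N (S k)) hK hKstep (fun k => vertexFamilyW_vertexOfK (hK k) (hS k) hR N)
    (fun k => vertexFamilyW_vertexOfK_step hK hKstep hS hSstep hR N k) hW hWstep hR μ ν

/-- **END, ONE-STEP DATA ON THE PRIMITIVES** (no `K_∞, S_∞, W_∞`): `GeomRate` of the second moments to the telescoped limit with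
`c₀ = betaPrime510 (d+1) (lipW …/(1−θ)) (R·N)`. [folklore] -/
theorem geomRate_secondMoment_hessKer_primitivesW_step (hK : ∀ k, ColW (K k) R BK)
    (hKstep : ∀ k, ColW (K (k + 1) - K k) R (cK * θ ^ k))
    (hS : ∀ k, LocStencilW (S k) (R / 2) Bs) (hSstep : ∀ k, LocStencilW (S (k + 1) - S k) (R / 2) (cS * θ ^ k))
    (hW : ∀ k, VertexFamily₂W (W k) N R BW) (hWstep : ∀ k, VertexFamily₂W (W (k + 1) - W k) N R (cW * θ ^ k)) (hR : 0 < R)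
    (hN : 1 ≤ N) (hθ0 : 0 ≤ θ) (hθ1 : θ < 1) (μ ν : Fin (d + 1)) :
    RateCertificate.GeomRate (fun k => B12Beta.secondMoment (hessKer (K k) (vertexOfK (K k) N (S k)) (W k)) μ ν)
      (B12Beta.secondMoment (limKernelOf (fun k => hessKer (K k) (vertexOfK (K k) N (S k)) (W k))) μ ν)
      (betaPrime510 (d + 1) (lipW BK BK (BK * Bs) (BK * Bs) BW cK (cK * Bs + BK * cS) cW / (1 - θ)) (R * N)) θ :=
  geomRate_secondMoment_hessKer_halfV_step (V := fun k => vertexOfK (K k) N (S k)) hK hKstep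
    (fun k => vertexFamilyW_vertexOfK (hK k) (hS k) hR N) (fun k => vertexFamilyW_vertexOfK_step hK hKstep hS hSstep hR N k)
    hW hWstep hR hN hθ0 hθ1 μ ν

/-- **END, ALL-SCALES DATA ON THE PRIMITIVES** (no `K_∞, S_∞, W_∞`): `GeomRate` of the second moments to the telescoped limit with THE
TREE'S constant `c₀ = betaPrime510 (d+1) (lipW B_K B_K (B_K B_s) (B_K B_s) B_W c_K (c_K B_s + B_K c_S) c_W) (R·N)` — the constant of
`HessKerSchur.geomRate_secondMoment_hessKer_primitivesW`, now without any limit object among the hypotheses. [folklore] -/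
theorem geomRate_secondMoment_hessKer_primitivesW_allScales (hK : ∀ k, ColW (K k) R BK)
    (hKall : ∀ k j, ColW (K (k + j) - K k) R (cK * θ ^ k))
    (hS : ∀ k, LocStencilW (S k) (R / 2) Bs) (hSall : ∀ k j, LocStencilW (S (k + j) - S k) (R / 2) (cS * θ ^ k))
    (hW : ∀ k, VertexFamily₂W (W k) N R BW) (hWall : ∀ k j, VertexFamily₂W (W (k + j) - W k) N R (cW * θ ^ k)) (hR : 0 < R)
    (hN : 1 ≤ N) (hθ0 : 0 ≤ θ) (hθ1 : θ < 1) (μ ν : Fin (d + 1)) :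
    RateCertificate.GeomRate (fun k => B12Beta.secondMoment (hessKer (K k) (vertexOfK (K k) N (S k)) (W k)) μ ν)
      (B12Beta.secondMoment (limKernelOf (fun k => hessKer (K k) (vertexOfK (K k) N (S k)) (W k))) μ ν)
      (betaPrime510 (d + 1) (lipW BK BK (BK * Bs) (BK * Bs) BW cK (cK * Bs + BK * cS) cW) (R * N)) θ :=
  geomRate_secondMoment_hessKer_halfV_allScales (V := fun k => vertexOfK (K k) N (S k)) hK hKall
    (fun k => vertexFamilyW_vertexOfK (hK k) (hS k) hR N) (fun k j => vertexFamilyW_vertexOfK_allScales hK hKall hS hSall hR N k j)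
    hW hWall hR hN hθ0 hθ1 μ ν

/-- … and the road-A2 socket `Drift.OneLoopDrift` about the telescoped limit, defect `c₀/(1−θ)`, from all-scales data. [folklore] -/
theorem oneLoopDrift_secondMoment_hessKer_primitivesW_allScales (hK : ∀ k, ColW (K k) R BK)
    (hKall : ∀ k j, ColW (K (k + j) - K k) R (cK * θ ^ k))
    (hS : ∀ k, LocStencilW (S k) (R / 2) Bs) (hSall : ∀ k j, LocStencilW (S (k + j) - S k) (R / 2) (cS * θ ^ k))
    (hW : ∀ k, VertexFamily₂W (W k) N R BW) (hWall : ∀ k j, VertexFamily₂W (W (k + j) - W k) N R (cW * θ ^ k)) (hR : 0 < R)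
    (hN : 1 ≤ N) (hθ0 : 0 ≤ θ) (hθ1 : θ < 1) (μ ν : Fin (d + 1)) :
    Drift.OneLoopDrift (B12Beta.secondMoment (limKernelOf (fun k => hessKer (K k) (vertexOfK (K k) N (S k)) (W k))) μ ν)
      (betaPrime510 (d + 1) (lipW BK BK (BK * Bs) (BK * Bs) BW cK (cK * Bs + BK * cS) cW) (R * N) / (1 - θ))
      (fun k => B12Beta.secondMoment (hessKer (K k) (vertexOfK (K k) N (S k)) (W k)) μ ν) :=
  (geomRate_secondMoment_hessKer_primitivesW_allScales hK hKall hS hSall hW hWall hR hN hθ0 hθ1 μ ν).drift hθ0 hθ1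

end Primitives

/-! ## §4 The resolvent between two FINITE levels — no limit operator -/

section Resolvent

variable {D : ℕ} {F : Type*} [Fintype F] [DecidableEq F]
variable {G H : ℕ → MKer D F} {R BG BH cH θ : ℝ}

/-- **ONE-STEP RESOLVENT BRICK.**  Two-sided inverse relations at EVERY level (`comp (G k) (H k) = idK`, `comp (H k) (G k) = idK`), uniform
`ColW` data at a rate `R > 0`, and CONSECUTIVE-SCALE operator deviations `ColW (H(k+1) − H k) R (c_H θ^k)` ⟹
`ColW (G(k+1) − G k) R (B_G c_H B_G θ^k)` — `HessKerSchurResolvent.colW_resolvent_sub` with `G := G(k+1)` (left inverse of `H(k+1)`),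
`G′ := G k` (right inverse of `H k`).  No `H_∞`, no `G_∞`. [folklore] -/
theorem colW_resolvent_step (hR : 0 < R) (hG : ∀ k, ColW (G k) R BG) (hH : ∀ k, ColW (H k) R BH)
    (hinvL : ∀ k, comp (G k) (H k) = idK) (hinvR : ∀ k, comp (H k) (G k) = idK)
    (hHstep : ∀ k, ColW (H (k + 1) - H k) R (cH * θ ^ k)) (k : ℕ) :
    ColW (G (k + 1) - G k) R (BG * cH * BG * θ ^ k) :=
  (colW_resolvent_sub hR (hG (k + 1)) (hG k) (hH (k + 1)) (hH k) (hinvL (k + 1)) (hinvR k) (colW_sub_comm (hHstep k))).mono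
    (le_of_eq (by ring))

/-- **ALL-SCALES RESOLVENT BRICK**: operator deviations `ColW (H(k+j) − H k) R (c_H θ^k)` for all `j` ⟹ resolvent deviations
`ColW (G(k+j) − G k) R (B_G c_H B_G θ^k)` for all `j`. [folklore] -/
theorem colW_resolvent_allScales (hR : 0 < R) (hG : ∀ k, ColW (G k) R BG) (hH : ∀ k, ColW (H k) R BH)
    (hinvL : ∀ k, comp (G k) (H k) = idK) (hinvR : ∀ k, comp (H k) (G k) = idK)
    (hHall : ∀ k j, ColW (H (k + j) - H k) R (cH * θ ^ k)) (k j : ℕ) :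
    ColW (G (k + j) - G k) R (BG * cH * BG * θ ^ k) :=
  (colW_resolvent_sub hR (hG (k + j)) (hG k) (hH (k + j)) (hH k) (hinvL (k + j)) (hinvR k) (colW_sub_comm (hHall k j))).mono
    (le_of_eq (by ring))

end Resolvent

section ResolventEnd

variable {d : ℕ}
variable {G H : ℕ → MKer (d + 1) (Fib d)} {S : ℕ → Fin (d + 1) → (Fin (d + 1) → ℤ) → MKer (d + 1) (Fib d)}
  {W : ℕ → Fin (d + 1) → (Fin (d + 1) → ℤ) → Fin (d + 1) → (Fin (d + 1) → ℤ) → MKer (d + 1) (Fib d)}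
  {R BG BH cH Bs cS BW cW θ : ℝ} {N : ℕ}

/-- **END FROM THE FINITE-LEVEL ONE-STEP OPERATORS, ONE-STEP DATA**: two-sided inverses at every level, uniform `ColW` data, consecutive-scale
operator / stencil / vertex deviations, `1 ≤ N`, `0 ≤ θ < 1` ⟹ `GeomRate` of the second moments of
`hessKer (G k) (vertexOfK (G k) N (S k)) (W k)` to the telescoped limit, `c₀ = betaPrime510 (d+1) (lipW …/(1−θ)) (R·N)` with the resolvent
deviation constant `c_K := B_G c_H B_G`. [folklore] -/
theorem geomRate_secondMoment_hessKer_operatorsW_step (hR : 0 < R) (hG : ∀ k, ColW (G k) R BG) (hH : ∀ k, ColW (H k) R BH)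
    (hinvL : ∀ k, comp (G k) (H k) = idK) (hinvR : ∀ k, comp (H k) (G k) = idK)
    (hHstep : ∀ k, ColW (H (k + 1) - H k) R (cH * θ ^ k))
    (hS : ∀ k, LocStencilW (S k) (R / 2) Bs) (hSstep : ∀ k, LocStencilW (S (k + 1) - S k) (R / 2) (cS * θ ^ k))
    (hW : ∀ k, VertexFamily₂W (W k) N R BW) (hWstep : ∀ k, VertexFamily₂W (W (k + 1) - W k) N R (cW * θ ^ k))
    (hN : 1 ≤ N) (hθ0 : 0 ≤ θ) (hθ1 : θ < 1) (μ ν : Fin (d + 1)) :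
    RateCertificate.GeomRate (fun k => B12Beta.secondMoment (hessKer (G k) (vertexOfK (G k) N (S k)) (W k)) μ ν)
      (B12Beta.secondMoment (limKernelOf (fun k => hessKer (G k) (vertexOfK (G k) N (S k)) (W k))) μ ν)
      (betaPrime510 (d + 1)
        (lipW BG BG (BG * Bs) (BG * Bs) BW (BG * cH * BG) (BG * cH * BG * Bs + BG * cS) cW / (1 - θ)) (R * N)) θ :=
  geomRate_secondMoment_hessKer_primitivesW_step hG (colW_resolvent_step hR hG hH hinvL hinvR hHstep) hS hSstep hW hWstep hR hN
    hθ0 hθ1 μ ν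

/-- **END FROM THE FINITE-LEVEL ONE-STEP OPERATORS, ALL-SCALES DATA**: the tree's constant (no `1/(1−θ)`) with `c_K := B_G c_H B_G`.
[folklore] -/
theorem geomRate_secondMoment_hessKer_operatorsW_allScales (hR : 0 < R) (hG : ∀ k, ColW (G k) R BG) (hH : ∀ k, ColW (H k) R BH)
    (hinvL : ∀ k, comp (G k) (H k) = idK) (hinvR : ∀ k, comp (H k) (G k) = idK)
    (hHall : ∀ k j, ColW (H (k + j) - H k) R (cH * θ ^ k))
    (hS : ∀ k, LocStencilW (S k) (R / 2) Bs) (hSall : ∀ k j, LocStencilW (S (k + j) - S k) (R / 2) (cS * θ ^ k))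
    (hW : ∀ k, VertexFamily₂W (W k) N R BW) (hWall : ∀ k j, VertexFamily₂W (W (k + j) - W k) N R (cW * θ ^ k))
    (hN : 1 ≤ N) (hθ0 : 0 ≤ θ) (hθ1 : θ < 1) (μ ν : Fin (d + 1)) :
    RateCertificate.GeomRate (fun k => B12Beta.secondMoment (hessKer (G k) (vertexOfK (G k) N (S k)) (W k)) μ ν)
      (B12Beta.secondMoment (limKernelOf (fun k => hessKer (G k) (vertexOfK (G k) N (S k)) (W k))) μ ν)
      (betaPrime510 (d + 1)
        (lipW BG BG (BG * Bs) (BG * Bs) BW (BG * cH * BG) (BG * cH * BG * Bs + BG * cS) cW) (R * N)) θ :=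
  geomRate_secondMoment_hessKer_primitivesW_allScales hG (colW_resolvent_allScales hR hG hH hinvL hinvR hHall) hS hSall hW hWall
    hR hN hθ0 hθ1 μ ν

/-- … and the road-A2 socket `Drift.OneLoopDrift` from the finite-level operators (all-scales data), defect `c₀/(1−θ)`. [folklore] -/
theorem oneLoopDrift_secondMoment_hessKer_operatorsW_allScales (hR : 0 < R) (hG : ∀ k, ColW (G k) R BG)
    (hH : ∀ k, ColW (H k) R BH) (hinvL : ∀ k, comp (G k) (H k) = idK) (hinvR : ∀ k, comp (H k) (G k) = idK)
    (hHall : ∀ k j, ColW (H (k + j) - H k) R (cH * θ ^ k))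
    (hS : ∀ k, LocStencilW (S k) (R / 2) Bs) (hSall : ∀ k j, LocStencilW (S (k + j) - S k) (R / 2) (cS * θ ^ k))
    (hW : ∀ k, VertexFamily₂W (W k) N R BW) (hWall : ∀ k j, VertexFamily₂W (W (k + j) - W k) N R (cW * θ ^ k))
    (hN : 1 ≤ N) (hθ0 : 0 ≤ θ) (hθ1 : θ < 1) (μ ν : Fin (d + 1)) :
    Drift.OneLoopDrift (B12Beta.secondMoment (limKernelOf (fun k => hessKer (G k) (vertexOfK (G k) N (S k)) (W k))) μ ν)
      (betaPrime510 (d + 1)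
        (lipW BG BG (BG * Bs) (BG * Bs) BW (BG * cH * BG) (BG * cH * BG * Bs + BG * cS) cW) (R * N) / (1 - θ))
      (fun k => B12Beta.secondMoment (hessKer (G k) (vertexOfK (G k) N (S k)) (W k)) μ ν) :=
  (geomRate_secondMoment_hessKer_operatorsW_allScales hR hG hH hinvL hinvR hHall hS hSall hW hWall hN hθ0 hθ1 μ ν).drift hθ0 hθ1

end ResolventEnd

/-! ## §5 Pointwise (`Decays`-form) all-scales data on the primitives -/

section Pointwise

variable {d : ℕ}
variable {K : ℕ → MKer (d + 1) (Fib d)} {S : ℕ → Fin (d + 1) → (Fin (d + 1) → ℤ) → MKer (d + 1) (Fib d)}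
  {W : ℕ → Fin (d + 1) → (Fin (d + 1) → ℤ) → Fin (d + 1) → (Fin (d + 1) → ℤ) → MKer (d + 1) (Fib d)}
  {R C cK δK Cs cS δS Cw cW δW θ : ℝ} {N : ℕ}

/-- **END FROM POINTWISE ALL-SCALES DATA ON THE PRIMITIVES** (`Decays (K k) C δK`, `Decays (K(k+j) − K k) (c_K θ^k) δK`, `LocStencil`,
`VertexFamily₂` likewise), at any target rate `0 < R` with `R < δK`, `R/2 < δS`, `R < δW`: the tree's `_of_pointwise` constant, limit supplied
by telescoping — NO `K_∞, S_∞, W_∞`.  (Sup-norm majorants `e^{−κ|x−y|_∞}` enter through `FibreInverseDecay.exp_supNorm_le_exp_l1`, rate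
`κ/(d+1)`.) [folklore] -/
theorem geomRate_secondMoment_hessKer_primitivesW_of_pointwise_allScales
    (hK : ∀ k, Decays (K k) C δK) (hKall : ∀ k j, Decays (K (k + j) - K k) (cK * θ ^ k) δK)
    (hS : ∀ k, LocStencil (S k) Cs δS) (hSall : ∀ k j, LocStencil (S (k + j) - S k) (cS * θ ^ k) δS)
    (hW : ∀ k, VertexFamily₂ (W k) N Cw δW) (hWall : ∀ k j, VertexFamily₂ (W (k + j) - W k) N (cW * θ ^ k) δW)
    (hR : 0 < R) (hRK : R < δK) (hRS : R / 2 < δS) (hRW : R < δW) (hN : 1 ≤ N) (hθ0 : 0 ≤ θ) (hθ1 : θ < 1)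
    (μ ν : Fin (d + 1)) :
    RateCertificate.GeomRate (fun k => B12Beta.secondMoment (hessKer (K k) (vertexOfK (K k) N (S k)) (W k)) μ ν)
      (B12Beta.secondMoment (limKernelOf (fun k => hessKer (K k) (vertexOfK (K k) N (S k)) (W k))) μ ν)
      (betaPrime510 (d + 1)
        (lipW ((Fintype.card (Fib d) : ℝ) * C * Zl (d + 1) (δK - R)) ((Fintype.card (Fib d) : ℝ) * C * Zl (d + 1) (δK - R))
          ((Fintype.card (Fib d) : ℝ) * C * Zl (d + 1) (δK - R) * ((Fintype.card (Fib d) : ℝ) ^ 2 * Cs * Zl (d + 1) (δS - R / 2) ^ 2))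
          ((Fintype.card (Fib d) : ℝ) * C * Zl (d + 1) (δK - R) * ((Fintype.card (Fib d) : ℝ) ^ 2 * Cs * Zl (d + 1) (δS - R / 2) ^ 2))
          ((Fintype.card (Fib d) : ℝ) ^ 2 * Cw * Zl (d + 1) (δW - R) ^ 2)
          ((Fintype.card (Fib d) : ℝ) * cK * Zl (d + 1) (δK - R))
          ((Fintype.card (Fib d) : ℝ) * cK * Zl (d + 1) (δK - R) * ((Fintype.card (Fib d) : ℝ) ^ 2 * Cs * Zl (d + 1) (δS - R / 2) ^ 2) +
            (Fintype.card (Fib d) : ℝ) * C * Zl (d + 1) (δK - R) * ((Fintype.card (Fib d) : ℝ) ^ 2 * cS * Zl (d + 1) (δS - R / 2) ^ 2))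
          ((Fintype.card (Fib d) : ℝ) ^ 2 * cW * Zl (d + 1) (δW - R) ^ 2))
        (R * N)) θ := by
  have hθK : ∀ k j, ColW (K (k + j) - K k) R ((Fintype.card (Fib d) : ℝ) * cK * Zl (d + 1) (δK - R) * θ ^ k) := fun k j =>
    (colW_of_decays (hKall k j) hRK).mono (le_of_eq (by ring))
  have hθS : ∀ k j, LocStencilW (S (k + j) - S k) (R / 2)
      ((Fintype.card (Fib d) : ℝ) ^ 2 * cS * Zl (d + 1) (δS - R / 2) ^ 2 * θ ^ k) := fun k j =>
    (locStencilW_of_locStencil (hSall k j) hRS).mono (le_of_eq (by ring))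
  have hθW : ∀ k j, VertexFamily₂W (W (k + j) - W k) N R ((Fintype.card (Fib d) : ℝ) ^ 2 * cW * Zl (d + 1) (δW - R) ^ 2 * θ ^ k) :=
    fun k j => (vertexFamily₂W_of_vertexFamily₂ (hWall k j) hRW).mono (le_of_eq (by ring))
  exact geomRate_secondMoment_hessKer_primitivesW_allScales (fun k => colW_of_decays (hK k) hRK) hθK
    (fun k => locStencilW_of_locStencil (hS k) hRS) hθS (fun k => vertexFamily₂W_of_vertexFamily₂ (hW k) hRW) hθW hR hN hθ0 hθ1 μ ν

end Pointwise

end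

end Literature.MathematicalPhysics.QuantumFieldTheory.Balaban1983to89.Beta.HessKerSchurCauchy
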